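import Summits.ValiantsHypothesis.ValiantsHypothesis.Theorems.BarrierLeverAnchoredDoorHitsLowerPairsStarFaces
import Mathlib.LinearAlgebra.Matrix.Block
import Mathlib.Algebra.Polynomial.Roots

/-!
# Route BarrierLever — support item `AnchoredDoorHitsLowerPairs` (stmt-ValiantsHypothesis-22510), line `anchored_peeling`:
# THE BALANCED VERTEX PIVOT FOR THE STAR-FOREST MATRIX (val-np-p1 g31)

A CLOSURE RULE for the door slot of record `Stmt.conjStarLower` (…StarDoor) at the level of the star-forest matrix itself (memo
HOME/val-np-p1/g31/MEMO-trop-valnp1-g31.md §2: the case `|E₀| = 1` of the graded tropical pivots, which has an EXACT factorisation).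
§1 VERTEX DELETION IDENTITIES (any commutative ring): an isolated row vertex (`g b₀ · = d b₀ · = 0` on `S`) can be dropped
(`starEntry_insert_row_isolated`), likewise a column vertex, and a pair `b₀, e₀` joined only by the column-leaf edge `d b₀ e₀` gives
`starEntry g d (insert b₀ A₀) (insert e₀ S₀) = (1 + d b₀ e₀) · starEntry g d A₀ S₀` (`starEntry_insert_insert`). §2 `exists_common_point`: two
star-forest determinants separately nonzero somewhere are simultaneously nonzero somewhere (restrict to the complex line through the two points).
§3 `starDet_ne_zero_of_pivot`: for LOWER families `u`, `w` of `r` faces and a permutation `σ` with `e₀ ∈ w (σ j) ↔ b₀ ∈ u j` (it exists iff the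
two vertex stars have equally many faces — BALANCE), nonsingular star blocks for the LINK pair `((u i) − b₀, (w (σ j)) − e₀)_{b₀ ∈ u i}` and the
DELETION pair `(u i, w (σ j))_{b₀ ∉ u i}` give one for `(u, w)`: at the pivot point the block is `(1 + [b₀ ∈ u i][e₀ ∈ w j]) · N i j`, `N` has
equal partner rows/columns (lowerness), and subtracting partners leaves `[b₀ ∈ u i ↔ e₀ ∈ w j] · N i j`, block triangular after `σ`
(`Matrix.twoBlockTriangular_det`). This is the star-matrix analogue of the line's `stub_starStep`; with `…StarFaces` it puts «balanced-vertex-peelable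
down to compressed / evaluation-good pairs» under `Stmt.conjStarTN` / `Stmt.conjStarLower` in the kernel. It does NOT prove `Stmt.conjStarLower`
(unbalanced deep pairs remain, memo §0 (F6)). Nothing here bears on crux 14610 or on `VP ≠ VNP`.
-/

set_option linter.dupNamespace false

namespace Summit.ValiantsHypothesis.ValiantsHypothesis.Theorems.BarrierLever.AnchoredPeeling

open Finset

noncomputable section

namespace StarDoor

variable {K : Type*} [CommRing K] {h : ℕ}

/-! ## 1. Vertex deletion identities -/

/-- Ring homomorphisms pass through `starEntry`. -/
theorem map_starEntry {L : Type*} [CommRing L] (f : K →+* L) (g d : Fin h → Fin h → K) (A S : Finset (Fin h)) :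
    f (starEntry g d A S) = starEntry (fun b e => f (g b e)) (fun b e => f (d b e)) A S := by
  unfold starEntry
  simp only [map_sum, map_mul, map_prod]

/-- `starEntry g d A S` only reads the weights on `A × S`. -/
theorem starEntry_congr {g g' d d' : Fin h → Fin h → K} {A S : Finset (Fin h)}
    (hg : ∀ b ∈ A, ∀ e ∈ S, g b e = g' b e) (hd : ∀ b ∈ A, ∀ e ∈ S, d b e = d' b e) :
    starEntry g d A S = starEntry g' d' A S := by
  unfold starEntry
  refine Finset.sum_congr rfl fun A' hA' => Finset.sum_congr rfl fun S' hS' => ?_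
  have hA'A : A' ⊆ A := Finset.mem_powerset.mp hA'
  have hS'S : S' ⊆ S := Finset.mem_powerset.mp hS'
  congr 1
  · refine Finset.prod_congr rfl fun b hb => Finset.sum_congr rfl fun e he => ?_
    exact hg b (Finset.mem_sdiff.mp hb).1 e (hS'S he)
  · refine Finset.prod_congr rfl fun e he => Finset.sum_congr rfl fun b hb => ?_
    exact hd b (hA'A hb) e (Finset.mem_sdiff.mp he).1

/-- Row expansion at a vertex `b₀` that is never a leaf (`g b₀ e = 0` on `S`): `b₀` is a centre with leaf set inside `S ∖ S'`, so
`starEntry g d (insert b₀ A₀) S = Σ_{T ⊆ A₀} Σ_{S' ⊆ S} (∏_{b ∈ A₀ ∖ T} Σ_{e ∈ S'} g b e) · ∏_{e ∈ S ∖ S'} (d b₀ e + Σ_{b ∈ T} d b e)`. -/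
theorem starEntry_insert_row_expand (g d : Fin h → Fin h → K) {A₀ S : Finset (Fin h)} {b₀ : Fin h} (hb₀ : b₀ ∉ A₀)
    (hg : ∀ e ∈ S, g b₀ e = 0) :
    starEntry g d (insert b₀ A₀) S = ∑ T ∈ A₀.powerset, ∑ S' ∈ S.powerset,
      (∏ b ∈ A₀ \ T, ∑ e ∈ S', g b e) * ∏ e ∈ S \ S', (d b₀ e + ∑ b ∈ T, d b e) := by
  classical
  unfold starEntry
  rw [Finset.sum_powerset_insert hb₀]
  have hzero : ∑ T ∈ A₀.powerset, ∑ S' ∈ S.powerset,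
      (∏ b ∈ insert b₀ A₀ \ T, ∑ e ∈ S', g b e) * ∏ e ∈ S \ S', ∑ b ∈ T, d b e = 0 := by
    refine Finset.sum_eq_zero fun T hT => Finset.sum_eq_zero fun S' hS' => ?_
    have hTA : T ⊆ A₀ := Finset.mem_powerset.mp hT
    have hS'S : S' ⊆ S := Finset.mem_powerset.mp hS'
    have hmem : b₀ ∈ insert b₀ A₀ \ T := by
      rw [Finset.mem_sdiff]
      exact ⟨Finset.mem_insert_self _ _, fun hbT => hb₀ (hTA hbT)⟩
    rw [Finset.prod_eq_zero hmem (Finset.sum_eq_zero fun e he => hg e (hS'S he)), zero_mul]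
  rw [hzero, zero_add]
  refine Finset.sum_congr rfl fun T hT => Finset.sum_congr rfl fun S' _ => ?_
  have hTA : T ⊆ A₀ := Finset.mem_powerset.mp hT
  have hb₀T : b₀ ∉ T := fun hbT => hb₀ (hTA hbT)
  have hsd : insert b₀ A₀ \ insert b₀ T = A₀ \ T := by
    rw [Finset.insert_sdiff_insert, Finset.sdiff_insert_of_notMem hb₀]
  rw [hsd]
  congr 1
  refine Finset.prod_congr rfl fun e _ => ?_
  rw [Finset.sum_insert hb₀T]

/-- **Isolated row vertex.** If `b₀ ∉ A₀` carries no edge into `S` (`g b₀ e = d b₀ e = 0` for `e ∈ S`) then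
`starEntry g d (insert b₀ A₀) S = starEntry g d A₀ S` (`b₀` can only be an isolated centre). -/
theorem starEntry_insert_row_isolated (g d : Fin h → Fin h → K) {A₀ S : Finset (Fin h)} {b₀ : Fin h} (hb₀ : b₀ ∉ A₀)
    (hg : ∀ e ∈ S, g b₀ e = 0) (hd : ∀ e ∈ S, d b₀ e = 0) :
    starEntry g d (insert b₀ A₀) S = starEntry g d A₀ S := by
  classical
  rw [starEntry_insert_row_expand g d hb₀ hg]
  unfold starEntry
  refine Finset.sum_congr rfl fun T _ => Finset.sum_congr rfl fun S' _ => ?_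
  congr 1
  refine Finset.prod_congr rfl fun e he => ?_
  rw [hd e (Finset.mem_sdiff.mp he).1, zero_add]

/-- **Isolated column vertex** (the transposed statement). -/
theorem starEntry_insert_col_isolated (g d : Fin h → Fin h → K) {A S₀ : Finset (Fin h)} {e₀ : Fin h} (he₀ : e₀ ∉ S₀)
    (hg : ∀ b ∈ A, g b e₀ = 0) (hd : ∀ b ∈ A, d b e₀ = 0) :
    starEntry g d A (insert e₀ S₀) = starEntry g d A S₀ := by
  rw [starEntry_swap, starEntry_insert_row_isolated (K := K) (fun e b => d b e) (fun e b => g b e) he₀ hd hg, ← starEntry_swap]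

/-- **A private edge.** If `b₀ ∉ A₀` and `e₀ ∉ S₀` are joined to nothing in `A₀ ⊔ S₀` and `b₀` is never a leaf, then
`starEntry g d (insert b₀ A₀) (insert e₀ S₀) = (1 + d b₀ e₀) · starEntry g d A₀ S₀` (either both are isolated centres, or `e₀` is the
unique leaf of the centre `b₀`). -/
theorem starEntry_insert_insert (g d : Fin h → Fin h → K) {A₀ S₀ : Finset (Fin h)} {b₀ e₀ : Fin h} (hb₀ : b₀ ∉ A₀)
    (he₀ : e₀ ∉ S₀) (h1 : ∀ e ∈ insert e₀ S₀, g b₀ e = 0) (h2 : ∀ b ∈ A₀, g b e₀ = 0) (h3 : ∀ e ∈ S₀, d b₀ e = 0)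
    (h4 : ∀ b ∈ A₀, d b e₀ = 0) :
    starEntry g d (insert b₀ A₀) (insert e₀ S₀) = (1 + d b₀ e₀) * starEntry g d A₀ S₀ := by
  classical
  rw [starEntry_insert_row_expand g d hb₀ h1]
  -- split the inner sum over `S' ⊆ insert e₀ S₀`
  have hsplit : ∀ T ∈ A₀.powerset,
      (∑ S' ∈ (insert e₀ S₀).powerset,
        (∏ b ∈ A₀ \ T, ∑ e ∈ S', g b e) * ∏ e ∈ insert e₀ S₀ \ S', (d b₀ e + ∑ b ∈ T, d b e))
      = d b₀ e₀ * (∑ S' ∈ S₀.powerset, (∏ b ∈ A₀ \ T, ∑ e ∈ S', g b e) * ∏ e ∈ S₀ \ S', ∑ b ∈ T, d b e)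
        + ∑ S' ∈ S₀.powerset, (∏ b ∈ A₀ \ T, ∑ e ∈ S', g b e) * ∏ e ∈ S₀ \ S', ∑ b ∈ T, d b e := by
    intro T hT
    have hTA : T ⊆ A₀ := Finset.mem_powerset.mp hT
    rw [Finset.sum_powerset_insert he₀, Finset.mul_sum]
    congr 1
    · refine Finset.sum_congr rfl fun S' hS' => ?_
      have hS'S : S' ⊆ S₀ := Finset.mem_powerset.mp hS'
      have he₀S' : e₀ ∉ S' := fun h => he₀ (hS'S h)
      have hsd : insert e₀ S₀ \ S' = insert e₀ (S₀ \ S') := Finset.insert_sdiff_of_notMem S₀ he₀S'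
      have hnot : e₀ ∉ S₀ \ S' := fun h => he₀ (Finset.mem_sdiff.mp h).1
      rw [hsd, Finset.prod_insert hnot]
      have hT0 : ∑ b ∈ T, d b e₀ = 0 := Finset.sum_eq_zero fun b hb => h4 b (hTA hb)
      rw [hT0, add_zero]
      have hrest : ∏ e ∈ S₀ \ S', (d b₀ e + ∑ b ∈ T, d b e) = ∏ e ∈ S₀ \ S', ∑ b ∈ T, d b e :=
        Finset.prod_congr rfl fun e he => by rw [h3 e (Finset.mem_sdiff.mp he).1, zero_add]
      rw [hrest]; ring
    · refine Finset.sum_congr rfl fun S' hS' => ?_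
      have hS'S : S' ⊆ S₀ := Finset.mem_powerset.mp hS'
      have he₀S' : e₀ ∉ S' := fun h => he₀ (hS'S h)
      have hsd : insert e₀ S₀ \ insert e₀ S' = S₀ \ S' := by
        rw [Finset.insert_sdiff_insert, Finset.sdiff_insert_of_notMem he₀]
      rw [hsd]
      have hgs : ∏ b ∈ A₀ \ T, ∑ e ∈ insert e₀ S', g b e = ∏ b ∈ A₀ \ T, ∑ e ∈ S', g b e :=
        Finset.prod_congr rfl fun b hb => by
          rw [Finset.sum_insert he₀S', h2 b (Finset.mem_sdiff.mp hb).1, zero_add]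
      have hrest : ∏ e ∈ S₀ \ S', (d b₀ e + ∑ b ∈ T, d b e) = ∏ e ∈ S₀ \ S', ∑ b ∈ T, d b e :=
        Finset.prod_congr rfl fun e he => by rw [h3 e (Finset.mem_sdiff.mp he).1, zero_add]
      rw [hgs, hrest]
  rw [Finset.sum_congr rfl hsplit, Finset.sum_add_distrib, ← Finset.mul_sum]
  unfold starEntry
  ring

/-! ## 2. Combining two certificates at one point -/

/-- **Two star-forest determinants that are separately nonzero somewhere are simultaneously nonzero somewhere.** (Restrict to the complex
line through the two points: each determinant is a nonzero polynomial in the line parameter, and a nonzero polynomial over `ℂ` has a non-root.) -/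
theorem exists_common_point {ι₁ ι₂ : Type*} [Fintype ι₁] [DecidableEq ι₁] [Fintype ι₂] [DecidableEq ι₂]
    (a₁ s₁ : ι₁ → Finset (Fin h)) (a₂ s₂ : ι₂ → Finset (Fin h))
    (H₁ : ∃ g d : Fin h → Fin h → ℂ, (Matrix.of fun i j : ι₁ => starEntry g d (a₁ i) (s₁ j)).det ≠ 0)
    (H₂ : ∃ g d : Fin h → Fin h → ℂ, (Matrix.of fun i j : ι₂ => starEntry g d (a₂ i) (s₂ j)).det ≠ 0) :
    ∃ g d : Fin h → Fin h → ℂ, (Matrix.of fun i j : ι₁ => starEntry g d (a₁ i) (s₁ j)).det ≠ 0 ∧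
      (Matrix.of fun i j : ι₂ => starEntry g d (a₂ i) (s₂ j)).det ≠ 0 := by
  classical
  obtain ⟨g₁, d₁, h₁⟩ := H₁
  obtain ⟨g₂, d₂, h₂⟩ := H₂
  -- the line `t ↦ (g₁ + t (g₂ - g₁), d₁ + t (d₂ - d₁))`, with polynomial coordinates
  let G : Fin h → Fin h → Polynomial ℂ := fun b e => Polynomial.C (g₁ b e) + Polynomial.X * Polynomial.C (g₂ b e - g₁ b e)
  let D : Fin h → Fin h → Polynomial ℂ := fun b e => Polynomial.C (d₁ b e) + Polynomial.X * Polynomial.C (d₂ b e - d₁ b e)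
  have hevG : ∀ t : ℂ, (fun b e => Polynomial.eval t (G b e)) = fun b e => g₁ b e + t * (g₂ b e - g₁ b e) := by
    intro t; funext b e; simp [G]
  have hevD : ∀ t : ℂ, (fun b e => Polynomial.eval t (D b e)) = fun b e => d₁ b e + t * (d₂ b e - d₁ b e) := by
    intro t; funext b e; simp [D]
  have hev₁ : ∀ t : ℂ, Polynomial.eval t (Matrix.of fun i j : ι₁ => starEntry G D (a₁ i) (s₁ j)).det = (Matrix.of fun i j : ι₁ =>
      starEntry (fun b e => g₁ b e + t * (g₂ b e - g₁ b e)) (fun b e => d₁ b e + t * (d₂ b e - d₁ b e)) (a₁ i) (s₁ j)).det := by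
    intro t
    rw [← Polynomial.coe_evalRingHom, RingHom.map_det, RingHom.mapMatrix_apply]
    congr 1; ext i j; simp only [Matrix.map_apply, Matrix.of_apply]; rw [map_starEntry]
    show starEntry (fun b e => Polynomial.eval t (G b e)) (fun b e => Polynomial.eval t (D b e)) (a₁ i) (s₁ j) = _
    rw [hevG, hevD]
  have hev₂ : ∀ t : ℂ, Polynomial.eval t (Matrix.of fun i j : ι₂ => starEntry G D (a₂ i) (s₂ j)).det = (Matrix.of fun i j : ι₂ =>
      starEntry (fun b e => g₁ b e + t * (g₂ b e - g₁ b e)) (fun b e => d₁ b e + t * (d₂ b e - d₁ b e)) (a₂ i) (s₂ j)).det := by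
    intro t
    rw [← Polynomial.coe_evalRingHom, RingHom.map_det, RingHom.mapMatrix_apply]
    congr 1; ext i j; simp only [Matrix.map_apply, Matrix.of_apply]; rw [map_starEntry]
    show starEntry (fun b e => Polynomial.eval t (G b e)) (fun b e => Polynomial.eval t (D b e)) (a₂ i) (s₂ j) = _
    rw [hevG, hevD]
  have hP₁ : (Matrix.of fun i j : ι₁ => starEntry G D (a₁ i) (s₁ j)).det ≠ 0 := by
    intro h0
    apply h₁
    have := hev₁ 0
    rw [h0, Polynomial.eval_zero] at this
    rw [this]; congr 1; ext i j; simp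
  have hP₂ : (Matrix.of fun i j : ι₂ => starEntry G D (a₂ i) (s₂ j)).det ≠ 0 := by
    intro h0
    apply h₂
    have := hev₂ 1
    rw [h0, Polynomial.eval_zero] at this
    rw [this]; congr 1; ext i j; simp
  have hP := mul_ne_zero hP₁ hP₂
  -- a nonzero complex polynomial has a non-root
  have hex : ∃ t : ℂ, ¬ ((Matrix.of fun i j : ι₁ => starEntry G D (a₁ i) (s₁ j)).det *
      (Matrix.of fun i j : ι₂ => starEntry G D (a₂ i) (s₂ j)).det).IsRoot t := by
    by_contra hall
    push Not at hall
    apply hP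
    apply Polynomial.eq_zero_of_infinite_isRoot
    have huniv : {x : ℂ | ((Matrix.of fun i j : ι₁ => starEntry G D (a₁ i) (s₁ j)).det *
        (Matrix.of fun i j : ι₂ => starEntry G D (a₂ i) (s₂ j)).det).IsRoot x} = Set.univ :=
      Set.eq_univ_of_forall fun x => hall x
    rw [huniv]
    exact Set.infinite_univ
  obtain ⟨t, ht⟩ := hex
  rw [Polynomial.IsRoot, Polynomial.eval_mul, mul_eq_zero, not_or] at ht
  refine ⟨fun b e => g₁ b e + t * (g₂ b e - g₁ b e), fun b e => d₁ b e + t * (d₂ b e - d₁ b e), ?_, ?_⟩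
  · rw [← hev₁ t]; exact ht.1
  · rw [← hev₂ t]; exact ht.2

/-! ## 3. The balanced vertex pivot -/

section Pivot

variable {r : ℕ} (u w : Fin r → Finset (Fin h)) (b₀ e₀ : Fin h)

/-- In a lower injective family every face through `b₀` has its face-minus-`b₀` in the family: the PARTNER index. -/
theorem exists_partner (hlu : IsLowerSet (Set.range u)) (i : Fin r) : ∃ i' : Fin r, u i' = (u i).erase b₀ := by
  obtain ⟨i', hi'⟩ := hlu (show (u i).erase b₀ ≤ u i from Finset.erase_subset _ _) ⟨i, rfl⟩
  exact ⟨i', hi'⟩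

/-- **THE BALANCED VERTEX PIVOT.** `u`, `w` lower families of `r` faces (injectivity is not even needed), `σ` a permutation of `Fin r` matching the columns through
`e₀` with the rows through `b₀` (`e₀ ∈ w (σ j) ↔ b₀ ∈ u j`). If the LINK pair (rows `(u i) − b₀`, columns `(w (σ j)) − e₀`, over the indices
with `b₀ ∈ u ·`) and the DELETION pair (rows `u i`, columns `w (σ j)`, over the indices with `b₀ ∉ u ·`) have nonsingular star-forest blocks, then
`(u, w)` has a nonsingular star-forest block. -/
theorem starDet_ne_zero_of_pivot
    (hlu : IsLowerSet (Set.range u)) (hlw : IsLowerSet (Set.range w)) (σ : Equiv.Perm (Fin r))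
    (hσ : ∀ j, e₀ ∈ w (σ j) ↔ b₀ ∈ u j)
    (Hlk : ∃ g d : Fin h → Fin h → ℂ,
      (Matrix.of fun i j : {i : Fin r // b₀ ∈ u i} => starEntry g d ((u i).erase b₀) ((w (σ j)).erase e₀)).det ≠ 0)
    (Hdl : ∃ g d : Fin h → Fin h → ℂ,
      (Matrix.of fun i j : {i : Fin r // b₀ ∉ u i} => starEntry g d (u i) (w (σ j))).det ≠ 0) :
    ∃ g d : Fin h → Fin h → ℂ, (Matrix.of fun i j : Fin r => starEntry g d (u i) (w j)).det ≠ 0 := by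
  classical
  obtain ⟨g, d, hlk, hdl⟩ := exists_common_point _ _ _ _ Hlk Hdl
  -- the pivot point: every edge at b₀ or e₀ killed except the column-leaf edge d b₀ e₀ = 1
  let g' : Fin h → Fin h → ℂ := fun b e => if b = b₀ ∨ e = e₀ then 0 else g b e
  let d' : Fin h → Fin h → ℂ := fun b e => if b = b₀ ∧ e = e₀ then 1 else if b = b₀ ∨ e = e₀ then 0 else d b e
  refine ⟨g', d', ?_⟩
  -- the matrix N of erased entries and the entrywise identity M = (1 + [b₀ ∈ u i][e₀ ∈ w j]) N
  let N : Matrix (Fin r) (Fin r) ℂ := Matrix.of fun i j => starEntry g d ((u i).erase b₀) ((w j).erase e₀)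
  have hN' : ∀ i j, starEntry g' d' ((u i).erase b₀) ((w j).erase e₀) = N i j := by
    intro i j
    apply starEntry_congr
    · intro b hb e he
      have hb' : b ≠ b₀ := Finset.ne_of_mem_erase hb
      have he' : e ≠ e₀ := Finset.ne_of_mem_erase he
      simp [g', hb', he']
    · intro b hb e he
      have hb' : b ≠ b₀ := Finset.ne_of_mem_erase hb
      have he' : e ≠ e₀ := Finset.ne_of_mem_erase he
      simp [d', hb', he']
  have hM : ∀ i j, starEntry g' d' (u i) (w j) =
      (if b₀ ∈ u i ∧ e₀ ∈ w j then 2 else 1) * N i j := by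
    intro i j
    rw [← hN' i j]
    by_cases hb : b₀ ∈ u i <;> by_cases he : e₀ ∈ w j
    · -- both: private edge
      rw [if_pos (show b₀ ∈ u i ∧ e₀ ∈ w j from ⟨hb, he⟩)]
      conv_lhs => rw [← Finset.insert_erase hb, ← Finset.insert_erase he]
      rw [starEntry_insert_insert g' d' (Finset.notMem_erase b₀ (u i)) (Finset.notMem_erase e₀ (w j))]
      · simp [d']; norm_num
      · intro e _; simp [g']
      · intro b hb'; simp [g']
      · intro e he'; have := Finset.ne_of_mem_erase he'; simp [d', this]
      · intro b hb'; have := Finset.ne_of_mem_erase hb'; simp [d', this]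
    · rw [if_neg (show ¬(b₀ ∈ u i ∧ e₀ ∈ w j) from fun h' => he h'.2), one_mul, Finset.erase_eq_of_notMem he]
      conv_lhs => rw [← Finset.insert_erase hb]
      rw [starEntry_insert_row_isolated g' d' (Finset.notMem_erase b₀ (u i))]
      · intro e _; simp [g']
      · intro e he'
        have hne : e ≠ e₀ := by rintro rfl; exact he he'
        simp [d', hne]
    · rw [if_neg (show ¬(b₀ ∈ u i ∧ e₀ ∈ w j) from fun h' => hb h'.1), one_mul, Finset.erase_eq_of_notMem hb]
      conv_lhs => rw [← Finset.insert_erase he]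
      rw [starEntry_insert_col_isolated g' d' (Finset.notMem_erase e₀ (w j))]
      · intro b _; simp [g']
      · intro b hb'
        have hne : b ≠ b₀ := by rintro rfl; exact hb hb'
        simp [d', hne]
    · rw [if_neg (show ¬(b₀ ∈ u i ∧ e₀ ∈ w j) from fun h' => hb h'.1), one_mul, Finset.erase_eq_of_notMem hb, Finset.erase_eq_of_notMem he]
  -- partners
  have hrow : ∀ i, ∃ i' : Fin r, u i' = (u i).erase b₀ := exists_partner u b₀ hlu
  have hcol : ∀ j, ∃ j' : Fin r, w j' = (w j).erase e₀ := exists_partner w e₀ hlw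
  choose p hp using hrow
  choose q hq using hcol
  have hNrow : ∀ i j, N (p i) j = N i j := fun i j => by simp only [N, Matrix.of_apply, hp i, Finset.erase_idem]
  have hNcol : ∀ i j, N i (q j) = N i j := fun i j => by simp only [N, Matrix.of_apply, hq j, Finset.erase_idem]
  -- row / column operation matrices
  let P : Matrix (Fin r) (Fin r) ℂ := Matrix.of fun i i' => if b₀ ∈ u i ∧ i' = p i then 1 else 0
  let Q : Matrix (Fin r) (Fin r) ℂ := Matrix.of fun j j' => if e₀ ∈ w j ∧ j' = q j then 1 else 0
  let M : Matrix (Fin r) (Fin r) ℂ := Matrix.of fun i j : Fin r => starEntry g' d' (u i) (w j)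
  have hMe : ∀ i j, M i j = (if b₀ ∈ u i ∧ e₀ ∈ w j then 2 else 1) * N i j := fun i j => hM i j
  have hPM : ∀ i j, (P * M) i j = if b₀ ∈ u i then M (p i) j else 0 := by
    intro i j
    rw [Matrix.mul_apply]
    by_cases hb : b₀ ∈ u i
    · rw [if_pos hb, Finset.sum_eq_single (p i)]
      · simp [P, hb]
      · intro i' _ hi'; simp [P, hi']
      · intro h'; exact (h' (Finset.mem_univ _)).elim
    · rw [if_neg hb]
      exact Finset.sum_eq_zero fun i' _ => by simp [P, hb]
  let M₂ : Matrix (Fin r) (Fin r) ℂ := (1 - P) * M * (1 - Q).transpose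
  have hX : ∀ i j, ((1 - P) * M) i j = (if b₀ ∈ u i then (if e₀ ∈ w j then (1 : ℂ) else 0) else 1) * N i j := by
    intro i j
    rw [Matrix.sub_mul, Matrix.one_mul, Matrix.sub_apply, hPM i j, hMe i j]
    by_cases hb : b₀ ∈ u i
    · have hpb : b₀ ∉ u (p i) := by rw [hp i]; exact Finset.notMem_erase b₀ (u i)
      rw [if_pos hb, hMe (p i) j, hNrow i j, if_neg (show ¬(b₀ ∈ u (p i) ∧ e₀ ∈ w j) from fun h' => hpb h'.1), if_pos hb]
      by_cases he : e₀ ∈ w j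
      · rw [if_pos (show b₀ ∈ u i ∧ e₀ ∈ w j from ⟨hb, he⟩), if_pos he]; ring
      · rw [if_neg (show ¬(b₀ ∈ u i ∧ e₀ ∈ w j) from fun h' => he h'.2), if_neg he]; ring
    · rw [if_neg hb, if_neg (show ¬(b₀ ∈ u i ∧ e₀ ∈ w j) from fun h' => hb h'.1), if_neg hb]; ring
  have hM₂ : ∀ i j, M₂ i j = (if (b₀ ∈ u i ↔ e₀ ∈ w j) then (1 : ℂ) else 0) * N i j := by
    intro i j
    show ((1 - P) * M * (1 - Q).transpose) i j = _
    rw [Matrix.mul_apply]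
    have hterm : ∀ j', ((1 - P) * M) i j' * (1 - Q).transpose j' j =
        ((1 - P) * M) i j' * ((if j = j' then (1 : ℂ) else 0) - (if e₀ ∈ w j ∧ j' = q j then 1 else 0)) := by
      intro j'
      simp only [Matrix.transpose_apply, Matrix.sub_apply, Matrix.one_apply, Q, Matrix.of_apply]
    rw [Finset.sum_congr rfl fun j' _ => hterm j']
    simp only [mul_sub, Finset.sum_sub_distrib, mul_ite, mul_one, mul_zero, Finset.sum_ite_eq,
      Finset.mem_univ, if_true]
    by_cases he : e₀ ∈ w j
    · have hqe : e₀ ∉ w (q j) := by rw [hq j]; exact Finset.notMem_erase e₀ (w j)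
      have hsum : ∑ j' : Fin r, (if e₀ ∈ w j ∧ j' = q j then ((1 - P) * M) i j' else 0) = ((1 - P) * M) i (q j) := by
        rw [Finset.sum_eq_single (q j)]
        · simp [he]
        · intro j' _ hj'; simp [hj']
        · intro h'; exact (h' (Finset.mem_univ _)).elim
      rw [hsum, hX i j, hX i (q j), hNcol i j, if_pos he, if_neg hqe]
      by_cases hb : b₀ ∈ u i
      · rw [if_pos hb, if_pos hb, if_pos (iff_of_true hb he)]; ring
      · rw [if_neg hb, if_neg hb, if_neg (fun h' => hb (h'.mpr he))]; ring
    · have hsum : ∑ j' : Fin r, (if e₀ ∈ w j ∧ j' = q j then ((1 - P) * M) i j' else 0) = 0 :=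
        Finset.sum_eq_zero fun j' _ => by simp [he]
      rw [hsum, sub_zero, hX i j, if_neg he]
      by_cases hb : b₀ ∈ u i
      · rw [if_pos hb, if_neg (fun h' => he (h'.mp hb))]
      · rw [if_neg hb, if_pos (iff_of_false hb he)]
  -- permute the columns by σ: block triangular for the predicate `b₀ ∈ u ·`
  let M₃ : Matrix (Fin r) (Fin r) ℂ := M₂.submatrix id σ
  have hM₃ : ∀ i j, M₃ i j = (if (b₀ ∈ u i ↔ b₀ ∈ u j) then (1 : ℂ) else 0) * N i (σ j) := by
    intro i j
    show M₂ i (σ j) = _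
    rw [hM₂ i (σ j)]
    by_cases hb : b₀ ∈ u i <;> by_cases hb' : b₀ ∈ u j <;> simp [hb, hb', hσ j]
  have hdet₃ : M₃.det = (Matrix.toSquareBlockProp M₃ (fun i => b₀ ∈ u i)).det *
      (Matrix.toSquareBlockProp M₃ (fun i => ¬ b₀ ∈ u i)).det := by
    apply Matrix.twoBlockTriangular_det
    intro i hi j hj
    rw [hM₃ i j, if_neg (fun h' => hi (h'.mpr hj)), zero_mul]
  -- the two diagonal blocks are the link block and the deletion block
  have hblk₁ : Matrix.toSquareBlockProp M₃ (fun i => b₀ ∈ u i) =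
      Matrix.of fun i j : {i : Fin r // b₀ ∈ u i} => starEntry g d ((u i).erase b₀) ((w (σ j)).erase e₀) := by
    rw [Matrix.toSquareBlockProp_def]
    ext i j
    simp only [Matrix.of_apply]
    rw [hM₃ i j, if_pos (iff_of_true i.2 j.2), one_mul]; simp only [N, Matrix.of_apply]
  have hblk₂ : Matrix.toSquareBlockProp M₃ (fun i => ¬ b₀ ∈ u i) =
      Matrix.of fun i j : {i : Fin r // b₀ ∉ u i} => starEntry g d (u i) (w (σ j)) := by
    rw [Matrix.toSquareBlockProp_def]
    ext i j
    simp only [Matrix.of_apply]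
    rw [hM₃ i j, if_pos (iff_of_false i.2 j.2), one_mul]
    simp only [N, Matrix.of_apply]
    have hej : e₀ ∉ w (σ j) := fun h' => j.2 ((hσ j).mp h')
    rw [Finset.erase_eq_of_notMem i.2, Finset.erase_eq_of_notMem hej]
  have hdet₃ne : M₃.det ≠ 0 := by
    rw [hdet₃, hblk₁, hblk₂]
    exact mul_ne_zero hlk hdl
  -- det M₃ = sign σ · det M₂ and det M₂ = det (1 - P) · det M · det (1 - Q)ᵀ
  intro hM0
  apply hdet₃ne
  have h2 : M₂.det = 0 := by
    show ((1 - P) * M * (1 - Q).transpose).det = 0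
    rw [Matrix.det_mul, Matrix.det_mul]
    have : M.det = 0 := hM0
    rw [this, mul_zero, zero_mul]
  show (M₂.submatrix id σ).det = 0
  rw [Matrix.det_permute', h2, mul_zero]

end Pivot

end StarDoor

end

end Summit.ValiantsHypothesis.ValiantsHypothesis.Theorems.BarrierLever.AnchoredPeeling
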